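import Summits.BirchSwinnertonDyer.Rank1Residual.P2.CMKolyvaginSelmerDescentAtTwoLocal
import Summits.BirchSwinnertonDyer.BirchSwinnertonDyer.Theorems.RamifiedSevenEllipticUnitsLocalTorsionUnramifiedPlace
import Summits.BirchSwinnertonDyer.Rank1Residual.X12.CMRamifiedAdditive
import Literature.NumberTheory.EllipticCurves.LocalFixedPointsTwoDescentProofs
import Literature.NumberTheory.EllipticCurves.LocalTorsionAdditiveTamagawaProofs
import HarnessLib

/-!
# `P2` typed interface (cell `bsd-print-cf2`, seat ty2): the `p_F`-LOCAL BINDER of the `2^M`-Selmer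
# descent along `L = K(√d_F) ⊃ K` DISCHARGED on the habitat — MEMO stub S2 binder-free:
# `#Sel_{2^M}(E_L/L) = (#Sel_{2^M}(E_K/K))²`

Route `CMKolyvaginAtInertTwo`, crux `CMKolyvaginExactAtInertTwo` (stmt-BirchSwinnertonDyer-24277); MEMO
`Cruxes/CMExactDescentAtTwo/MEMO-inert-order-splitting.md` §5/§6 stub **S2** and §3 (a)'s «p_F-defect».
Sequel of `CMKolyvaginSelmerDescentAtTwoLocal` (p662320: the descent modulo the binder `hram` at the
places of `K` above `p_F = −d_F`). THEOREMS ONLY (0 defs / 0 facts / 0 sorry); no item is closed; BSD is not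
proved by this.

THE BINDER `hram` asked, at each place `v ∣ p_F` of `K` and some `w ∣ v` of `L`: the subgroup
`E(K̄_v)^{Γ_{L̃_w}}` of `E(K̄_v)` has no `2^M`-torsion and is `2^M`-divisible. It is discharged here:

* `forall_eq_zero_of_two_smul_eq_zero_adicCompletion_of_cmFieldDiscr_mem` — **`E_K(K_v)[2] = 0` at
  `v ∣ p_F`**: `d_F = −p_F` with `p_F` an odd prime (`exists_prime_cmFieldDiscr_eq_neg_of_cmInert_two`);
  `E/ℚ` is ADDITIVE at `p_F` (CM, `p_F ∣ d_F`: `X12.addv_of_hasCM_of_cmRamified`); `p_F ∣ N_E`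
  (`cmPrime_dvd_conductorNorm_of_cmInert_two`) so `p_F` splits in the Heegner field `K`, `e(v|p_F) = 1`
  (`AdditiveKoly.SplitCompletion.ramificationIdx_eq_one_of_card_primesOver`) and `E_K` is additive at `v`
  (Silverman VII.5.4 (a): `hasAdditiveReductionAt_baseChange_of_ramificationIdx_eq_one` with the tree's
  theorem `kodairaSymbolAt_baseChange_of_ramificationIdx_eq_one_holds`); `c_v(E_K)` is odd
  (`TamagawaSelmerAtTwo.odd_localTamagawaNumber_baseChange_of_isImaginaryQuadratic`) and `v ∤ 2`, so
  `#E_K(K_v)[2] ∣ c_v · q_v` is odd, i.e. `E_K(K_v)[2] = 0` (ty2's Literature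
  `forall_eq_zero_of_prime_pow_smul_eq_zero_of_hasAdditiveReductionAt_of_not_dvd`, Silverman VII.2.1/3.1).
* `exists_fixedPoints_twoPow_of_cmFieldDiscr_mem` — **`hram` itself**: ty2's Literature
  `fixedPoints_twoPow_torsionFree_and_divisible_adicCompletion` (Galois descent of `E(K̄_v)^{Γ_{L̃_w}}` to
  `E(L_w)`, the index-`2` orbit argument `E(K_v)[2] = 0 ⟹ E(L_w)[2^M] = 0`, and Milne I.3.3 at `w ∤ 2`),
  fed with the previous item, `L = K + K θ`, `θ² = d_F ≠ 0`.
* `mem_selmerGroup_baseChange_of_resTorsion_mem_of_heegner` — **EXACT LOCAL DESCENT, binder-free**: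
  `res x ∈ Sel_{2^M}(E_L/L) ⟹ x ∈ Sel_{2^M}(E_K/K)` on the habitat.
* `natCard_selmer_baseChange_tower_eq_sq` — **MEMO STUB S2's OUTPUT ON `H₂`, binder-free:
  `#Sel_{2^M}(E_L/L) = (#Sel_{2^M}(E_K/K))²`** for `E/ℚ` globally minimal with CM, `2` inert in `F`,
  `ρ̄_{E,2}` onto, `∏ c_p` odd, `K` imaginary quadratic with the Heegner hypothesis, `L ⊇ K` quadratic
  containing `√d_F`. The memo's «p_F-defect» is `1` on this habitat.

beyond-print theorem: NO (Dokchitser–Dokchitser 2010, proof of Lemma 4.14; Milne ADT I.3.3/I.3.8; Silverman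
AEC VII–VIII; Gross 1991 §1). BSD is not proved by any of this; no summit statement is proved by this seat.

References: [DokchitserDokchitserAnnals2010] Lemma 4.14 (proof); [MilneADT2006] I Lemma 3.3, Prop. 3.8;
[SilvermanAEC2009] VII.2.1, VII.3.1, VII.5.4 (a), VIII.§1; [GrossLMS1991] §1, §6 Prop. 6.2 (1); [Lang1987] Ch. 10 §4.
-/

set_option autoImplicit false

noncomputable section

open scoped Classical

namespace Summit.BirchSwinnertonDyer.Rank1Residual.P2.SelmerDescentAtTwo

open WeierstrassCurve Field NumberField IsDedekindDomain
open IsDedekindDomain (HeightOneSpectrum)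
open Literature.NumberTheory.EllipticCurves Literature.NumberTheory.EllipticCurves.Rank1Residual
open Literature.NumberTheory.GaloisRepresentations
open Literature.NumberTheory.DiophantineGeometry
open Summit.BirchSwinnertonDyer.BirchSwinnertonDyer.Theorems
open Summit.BirchSwinnertonDyer.Rank1Residual Summit.BirchSwinnertonDyer.Rank1Residual.X11b

variable (W : WeierstrassCurve ℚ) [W.IsElliptic]
variable {K L : Type} [Field K] [NumberField K] [Field L] [NumberField L] [Algebra K L]

/-- **`E_K(K_v)[2] = 0` at the places of the Heegner field above `p_F`.** For `E = W/ℚ` globally minimal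
with CM, `2` inert in `F` (`d_F = −p_F`, `p_F` an odd prime), `∏_p c_p(E)` odd, and `K` imaginary
quadratic with the Heegner hypothesis for `N_E`: at every place `v` of `K` with `d_F ∈ v` (i.e. `v ∣ p_F`),
`E_K` has additive reduction (`E` is additive at `p_F ∣ d_F`, `p_F ∣ N_E` splits in `K`, Silverman
VII.5.4 (a)), `c_v(E_K)` is odd and `v ∤ 2`, so `E_K(K_v)` has no point of order `2`
(`#E_K(K_v)[2] ∣ c_v q_v`, Silverman VII.2.1/VII.3.1). [cite: SilvermanAEC2009, Prop. VII.2.1, Prop. VII.3.1, Prop. VII.5.4 (a)]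
[cite: SilvermanATAEC1994, Thm. II.6.4] [cite: GrossLMS1991, §1 and §6 Prop. 6.2 (1)] -/
theorem forall_eq_zero_of_two_smul_eq_zero_adicCompletion_of_cmFieldDiscr_mem [W.IsGloballyMinimal]
    (hCM : W.HasCM) (hin : CMInert W 2) (hodd : Odd W.tamagawaProduct) (hK : IsImaginaryQuadratic K)
    (hH : SatisfiesHeegnerHypothesis (W.conductorNorm ℤ) K) (v : HeightOneSpectrum (𝓞 K))
    (hv : ((cmFieldDiscrOfJ W.j : ℤ) : 𝓞 K) ∈ v.asIdeal)
    (R : ((W.baseChange K).baseChange (v.adicCompletion K)).toAffine.Point) (hR : (2 : ℤ) • R = 0) :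
    R = 0 := by
  haveI : (W.baseChange K).IsElliptic := by rw [baseChange]; infer_instance
  -- `d_F = -ℓ`, `ℓ` an odd prime, `ℓ ∈ v`
  obtain ⟨ℓ, hℓ, hℓ2, hdF⟩ := KolyvaginFrobeniusTwo.exists_prime_cmFieldDiscr_eq_neg_of_cmInert_two W hin
  haveI : Fact ℓ.Prime := ⟨hℓ⟩
  have hℓv : ((ℓ : ℕ) : 𝓞 K) ∈ v.asIdeal := by
    have h1 : ((cmFieldDiscrOfJ W.j : ℤ) : 𝓞 K) = -((ℓ : ℕ) : 𝓞 K) := by rw [hdF]; push_cast; ring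
    rw [h1] at hv
    exact neg_mem_iff.mp hv
  -- the place of `ℚ` below `v` is the one at `ℓ`; `2 ∉ v`
  set v₀ : HeightOneSpectrum (𝓞 ℚ) := v.under (𝓞 ℚ) with hv₀def
  haveI : v.asIdeal.LiesOver v₀.asIdeal := ⟨rfl⟩
  have hv₀ : v.under (𝓞 ℚ) = ratPlace ℓ := under_eq_ratPlace_of_mem hℓv
  have hℓeq : (Rat.HeightOneSpectrum.primesEquiv v₀ : ℕ) = ℓ := by
    rw [hv₀def, hv₀, primesEquiv_ratPlace]
  have h2v : ((2 : ℕ) : 𝓞 K) ∉ v.asIdeal := by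
    intro h2
    haveI : Fact (2 : ℕ).Prime := ⟨Nat.prime_two⟩
    have h1 : v.under (𝓞 ℚ) = ratPlace 2 := under_eq_ratPlace_of_mem h2
    have h3 : (Rat.HeightOneSpectrum.primesEquiv (v.under (𝓞 ℚ)) : ℕ) = 2 := by
      rw [h1, primesEquiv_ratPlace]
    rw [← hv₀def, hℓeq] at h3
    exact hℓ2 h3
  -- additive at `v₀`, then at `v` along the unramified `v | v₀` (`ℓ ∣ N_E` splits in `K`)
  have haddv : Addv W ℓ :=
    X12.addv_of_hasCM_of_cmRamified W ℓ hCM hℓ2 (by rw [CMRamified, hdF]; exact dvd_neg.mpr dvd_rfl)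
  have hadd₀ : W.HasAdditiveReductionAt v₀ :=
    RamifiedSevenEllipticUnits.hasAdditiveReductionAt_ratPlace_of_not_good_of_not_mult W ℓ haddv.1
      haddv.2 v₀ hℓeq
  have hℓN : ℓ ∣ W.conductorNorm ℤ :=
    KolyvaginFrobeniusTwo.cmPrime_dvd_conductorNorm_of_cmInert_two W hCM hℓ hℓ2 hdF
  have he : v.asIdeal.ramificationIdx (𝓞 ℚ) = 1 :=
    AdditiveKoly.SplitCompletion.ramificationIdx_eq_one_of_card_primesOver K ℓ hK.1 (hH ℓ hℓ hℓN) v hℓv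
  haveI : PerfectField (IsLocalRing.ResidueField (v₀.adicCompletionIntegers ℚ)) := PerfectField.ofFinite
  haveI : Finite (IsLocalRing.ResidueField (v.adicCompletionIntegers K)) :=
    HeightOneSpectrum.finite_residueField_adicCompletionIntegers K v
  haveI : PerfectField (IsLocalRing.ResidueField (v.adicCompletionIntegers K)) := PerfectField.ofFinite
  have hc : (algebraMap ℚ K).comp (algebraMap (𝓞 ℚ) ℚ) =
      (algebraMap (𝓞 K) K).comp (algebraMap (𝓞 ℚ) (𝓞 K)) := by
    rw [← IsScalarTower.algebraMap_eq, ← IsScalarTower.algebraMap_eq]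
  have hwv : v.asIdeal.under (𝓞 ℚ) = v₀.asIdeal := rfl
  have haddK : (W.baseChange K).HasAdditiveReductionAt v :=
    hasAdditiveReductionAt_baseChange_of_ramificationIdx_eq_one
      (UnramifiedBaseChange.kodairaSymbolAt_baseChange_of_ramificationIdx_eq_one_holds K v₀ v W)
      hc hwv (KolyvaginHloc.not_map_le_sq_of_ramificationIdx_eq_one' hwv he) hadd₀
  -- `c_v(E_K)` odd
  have hcodd := TamagawaSelmerAtTwo.odd_localTamagawaNumber_baseChange_of_isImaginaryQuadratic W K hodd
    hK hH v
  have hpc : ¬ 2 ∣ ((W.baseChange K).baseChange (v.adicCompletion K)).localTamagawaNumber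
      (v.adicCompletionIntegers K) := hcodd.not_two_dvd_nat
  have hR' : (2 ^ 1 : ℕ) • R = 0 := by
    rw [pow_one, ← natCast_zsmul]
    exact_mod_cast hR
  exact (W.baseChange K).forall_eq_zero_of_prime_pow_smul_eq_zero_of_hasAdditiveReductionAt_of_not_dvd v
    haddK Nat.prime_two h2v hpc 1 R hR'

omit [NumberField K] in
/-- `2 ∉ v` when `d_F ∈ v` (`d_F` odd: `d_F ∈ {−3, −11, −19, −43, −67, −163}`). [cite: SilvermanATAEC1994, App. A §3] -/
private theorem two_not_mem_of_cmFieldDiscr_mem (hin : CMInert W 2) (v : HeightOneSpectrum (𝓞 K))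
    (hv : ((cmFieldDiscrOfJ W.j : ℤ) : 𝓞 K) ∈ v.asIdeal) : ((2 : ℕ) : 𝓞 K) ∉ v.asIdeal := by
  intro h2
  obtain ⟨k, hk⟩ := exists_cmFieldDiscrOfJ_eq_four_mul_add_one W hin
  have h1 : (1 : 𝓞 K) = ((cmFieldDiscrOfJ W.j : ℤ) : 𝓞 K) - ((2 : ℕ) : 𝓞 K) * ((2 * k : ℤ) : 𝓞 K) := by
    rw [hk]; push_cast; ring
  have hmem : (1 : 𝓞 K) ∈ v.asIdeal := by
    rw [h1]
    exact v.asIdeal.sub_mem hv (v.asIdeal.mul_mem_right _ h2)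
  exact v.isPrime.ne_top ((Ideal.eq_top_iff_one _).mpr hmem)

/-- **THE `p_F`-LOCAL BINDER DISCHARGED.** On the habitat (`E = W/ℚ` globally minimal with CM, `2` inert
in `F`, `∏ c_p` odd; `K` imaginary quadratic with the Heegner hypothesis; `L = K + K θ`, `θ² = d_F`): at
every place `v` of `K` above `p_F` and every `w ∣ v`, `E_K(K̄_v)^{Γ_{L̃_w}}` has no `2^M`-torsion and is
`2^M`-divisible (`fixedPoints_twoPow_torsionFree_and_divisible_adicCompletion`: Galois descent to
`E(L_w)`, `E_K(K_v)[2] = 0 ⟹ E(L_w)[2^M] = 0`, Milne I.3.3 at `w ∤ 2`) — the hypothesis `hram` of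
`mem_selmerGroup_baseChange_of_resTorsion_mem` / `natCard_selmer_baseChange_tower_eq_sq_of_sq_eq_cmFieldDiscr`.
[cite: SilvermanAEC2009, VIII.§1 and Prop. VII.6.3] [cite: MilneADT2006, I Lemma 3.3]
[cite: DokchitserDokchitserAnnals2010, Lemma 4.14 (proof)] -/
theorem exists_fixedPoints_twoPow_of_cmFieldDiscr_mem [W.IsGloballyMinimal] (hCM : W.HasCM)
    (hin : CMInert W 2) (hodd : Odd W.tamagawaProduct) (hK : IsImaginaryQuadratic K)
    (hH : SatisfiesHeegnerHypothesis (W.conductorNorm ℤ) K) (hLK : Module.finrank K L = 2) {θ : L}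
    (hθ : θ ^ 2 = algebraMap ℚ L (cmFieldDiscrOfJ W.j)) (hθK : θ ∉ Set.range (algebraMap K L)) (M : ℕ)
    (v : HeightOneSpectrum (𝓞 K)) (hv : ((cmFieldDiscrOfJ W.j : ℤ) : 𝓞 K) ∈ v.asIdeal) :
    ∃ (w : HeightOneSpectrum (𝓞 L)) (_ : w.asIdeal.LiesOver v.asIdeal),
      letI : Algebra (v.adicCompletion K) (w.adicCompletion L) :=
        (adicCompletionMap (K := K) L v w).toAlgebra
      (∀ a : localPoints (W.baseChange K) (v.adicCompletion K),
        (∀ g ∈ finGalSubgroup (E := v.adicCompletion K) (w.adicCompletion L), g • a = a) →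
          ((2 : ℤ) ^ M) • a = 0 → a = 0) ∧
      (∀ a : localPoints (W.baseChange K) (v.adicCompletion K),
        (∀ g ∈ finGalSubgroup (E := v.adicCompletion K) (w.adicCompletion L), g • a = a) →
          ∃ b : localPoints (W.baseChange K) (v.adicCompletion K),
            (∀ g ∈ finGalSubgroup (E := v.adicCompletion K) (w.adicCompletion L), g • b = b) ∧
              ((2 : ℤ) ^ M) • b = a) := by
  haveI : (W.baseChange K).IsElliptic := by rw [baseChange]; infer_instance
  obtain ⟨w, hw⟩ := exists_liesOver L v
  haveI := hw
  refine ⟨w, hw, ?_⟩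
  -- `2 ∉ w`
  have h2w : ((2 : ℕ) : 𝓞 L) ∉ w.asIdeal := by
    intro h2
    apply two_not_mem_of_cmFieldDiscr_mem W hin v hv
    have h1 : ((2 : ℕ) : 𝓞 K) ∈ w.asIdeal.under (𝓞 K) := by
      rw [Ideal.under_def, Ideal.mem_comap, map_natCast]
      exact h2
    rwa [← hw.over] at h1
  -- `L = K + K θ`, `θ² = d_F ≠ 0`
  have hL : ∀ y : L, ∃ a b : K, y = algebraMap K L a + algebraMap K L b * θ :=
    Literature.NumberTheory.QuadraticFields.Quadratic.exists_eq_add_mul hLK hθK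
  have hθ' : θ ^ 2 = algebraMap K L (algebraMap ℚ K (cmFieldDiscrOfJ W.j)) := by
    rw [hθ, IsScalarTower.algebraMap_apply ℚ K L]
  have hc : algebraMap ℚ K (cmFieldDiscrOfJ W.j) ≠ 0 := by
    rw [map_ne_zero_iff _ (algebraMap ℚ K).injective, Int.cast_ne_zero]
    exact X12.cmFieldDiscrOfJ_ne_zero_of_hasCM W hCM
  exact fixedPoints_twoPow_torsionFree_and_divisible_adicCompletion (W.baseChange K) L hc hθ' hL w h2w
    (fun P hP ↦ forall_eq_zero_of_two_smul_eq_zero_adicCompletion_of_cmFieldDiscr_mem W hCM hin hodd hK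
      hH v hv P hP) M

/-- **EXACT LOCAL DESCENT ON THE HABITAT, binder-free.** For `E = W/ℚ` globally minimal with CM, `2` inert
in `F`, `∏_p c_p(E)` odd; `K` imaginary quadratic with the Heegner hypothesis for `N_E`; `L ⊇ K` with
`[L : K] = 2` and `θ ∈ L ∖ K`, `θ² = d_F`: at every level `2^M`,
**`res x ∈ Sel_{2^M}(E_L/L) ⟹ x ∈ Sel_{2^M}(E_K/K)`**. [cite: DokchitserDokchitserAnnals2010, Lemma 4.14 (proof)]
[cite: MilneADT2006, I Prop. 3.8 and Lemma 3.3] [cite: GrossLMS1991, §1 and §6 Prop. 6.2 (1)] -/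
theorem mem_selmerGroup_baseChange_of_resTorsion_mem_of_heegner [W.IsGloballyMinimal] (hCM : W.HasCM)
    (hin : CMInert W 2) (hodd : Odd W.tamagawaProduct) (hK : IsImaginaryQuadratic K)
    (hH : SatisfiesHeegnerHypothesis (W.conductorNorm ℤ) K) (hLK : Module.finrank K L = 2) {θ : L}
    (hθ : θ ^ 2 = algebraMap ℚ L (cmFieldDiscrOfJ W.j)) (hθK : θ ∉ Set.range (algebraMap K L)) (M : ℕ)
    {x : galH1Torsion (W.baseChange K) ((2 : ℤ) ^ M)}
    (hx : resTorsion (W.baseChange K) L ((2 : ℤ) ^ M) x ∈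
      selmerGroup ((W.baseChange K).baseChange L) ((2 : ℤ) ^ M)) :
    x ∈ selmerGroup (W.baseChange K) ((2 : ℤ) ^ M) :=
  mem_selmerGroup_baseChange_of_resTorsion_mem W hin hodd hK hH hLK hθ hθK M
    (fun v hv ↦ exists_fixedPoints_twoPow_of_cmFieldDiscr_mem W hCM hin hodd hK hH hLK hθ hθK M v hv) hx

/-- `θ ∉ K` for `θ² = d_F` on the habitat: otherwise `Δ_E = d_F s² = (θ s)²` would be a square in the
Heegner field `K` (`not_isSquare_algebraMap_Δ_of_cmInert_two_of_heegner`,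
`exists_Δ_eq_cmFieldDiscr_mul_sq_of_cmInert_two`). [cite: DokchitserDokchitserMathZ2012, Thm. 1]
[cite: SilvermanATAEC1994, App. A §3] -/
theorem not_mem_range_of_sq_eq_cmFieldDiscr [W.IsGloballyMinimal] (hCM : W.HasCM) (hin : CMInert W 2)
    (hsurj : W.HasSurjectiveModNGaloisRep 2) (hK : IsImaginaryQuadratic K)
    (hH : SatisfiesHeegnerHypothesis (W.conductorNorm ℤ) K) {θ : L}
    (hθ : θ ^ 2 = algebraMap ℚ L (cmFieldDiscrOfJ W.j)) : θ ∉ Set.range (algebraMap K L) := by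
  obtain ⟨-, s, hs⟩ := KolyvaginFrobeniusTwo.exists_Δ_eq_cmFieldDiscr_mul_sq_of_cmInert_two W hCM hin hsurj
  rintro ⟨t, ht⟩
  apply KolyvaginImageTwo.not_isSquare_algebraMap_Δ_of_cmInert_two_of_heegner W hCM hin hsurj K hK hH
  refine ⟨t * algebraMap ℚ K s, (algebraMap K L).injective ?_⟩
  have h1 : algebraMap K L (algebraMap ℚ K W.Δ) = algebraMap ℚ L W.Δ :=
    (IsScalarTower.algebraMap_apply ℚ K L _).symm
  have h2 : algebraMap K L (algebraMap ℚ K s) = algebraMap ℚ L s :=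
    (IsScalarTower.algebraMap_apply ℚ K L _).symm
  rw [h1, map_mul, map_mul, h2, ht, hs, map_mul, map_pow, ← hθ]
  ring

/-- **MEMO STUB S2's OUTPUT ON `H₂ = K·F`, BINDER-FREE: `#Sel_{2^M}(E_L/L) = (#Sel_{2^M}(E_K/K))²`.**
For `E = W/ℚ` globally minimal with CM, `2` inert in `F = ℚ(√d_F)`, `ρ̄_{E,2}` onto, `∏_p c_p(E)` odd;
`K` imaginary quadratic with the Heegner hypothesis for `N_E`; `L ⊇ K` with `[L : K] = 2` containing `θ`,
`θ² = d_F`; every `M`. The Selmer descent `Sel_{2^M}(E/K) ≅ Sel_{2^M}(E_L/L)^{σ}` (p660127) with EXACT local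
descent everywhere — unramified places by Milne I.3.8 and odd `c_v` (p662320), the places above `p_F` by
`E_K(K_v)[2] = 0` (this file): the memo's «p_F-defect» is `1` — and ty2 g28's
`#Sel_{2^M}(E_L/L) = (#Sel_{2^M}(E_L/L)^{σ})²`. [cite: Lang1987, Ch. 10 §4, Remark]
[cite: DokchitserDokchitserAnnals2010, Lemma 4.14 (proof)] [cite: SerreGaloisCohomology1997, I §2.6 (b)]
[cite: GrossLMS1991, §1 and §6 Prop. 6.2 (1)] -/
theorem natCard_selmer_baseChange_tower_eq_sq [W.IsGloballyMinimal] (hCM : W.HasCM) (hin : CMInert W 2)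
    (hsurj : W.HasSurjectiveModNGaloisRep 2) (hodd : Odd W.tamagawaProduct) (hK : IsImaginaryQuadratic K)
    (hH : SatisfiesHeegnerHypothesis (W.conductorNorm ℤ) K) (hLK : Module.finrank K L = 2) {θ : L}
    (hθ : θ ^ 2 = algebraMap ℚ L (cmFieldDiscrOfJ W.j)) (M : ℕ) :
    Nat.card (selmerGroup (W.baseChange L) ((2 : ℤ) ^ M)) =
      Nat.card (selmerGroup (W.baseChange K) ((2 : ℤ) ^ M)) ^ 2 :=
  natCard_selmer_baseChange_tower_eq_sq_of_sq_eq_cmFieldDiscr W hCM hin hsurj hodd hK hH hLK hθ M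
    fun v hv ↦ exists_fixedPoints_twoPow_of_cmFieldDiscr_mem W hCM hin hodd hK hH hLK hθ
      (not_mem_range_of_sq_eq_cmFieldDiscr W hCM hin hsurj hK hH hθ) M v hv

end Summit.BirchSwinnertonDyer.Rank1Residual.P2.SelmerDescentAtTwo
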